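import Summits.Ventures.Crystal3D.Theorems.StickyWulffConstantCoaxialWallLawEndRowDefs
import HarnessLib

/-!
# The mover predicates depend on the frame only through its slot dozen (crux `CoaxialWallLaw`, line `WallLedgerF`)

HONEST FRAMING. Venture `Summits/Ventures/Crystal3D` (cell `crystal3d-full`), helper `--supports` the crux
`CoaxialWallLaw` (stmt-Ventures-19481, `route-Ventures-StickyWulffConstant`), REGISTERED line `WallLedgerF` (planner
cf-p1).  Rung credit; F-C1 not moved; pure bookkeeping on the definitions of `…EndRowDefs`.  Used by the on-site bridge
(cf-p1 ORDER 2026-08-28T21:28:15Z item (2)): after the frame lemma and the class collapse pin the slot dozen of a mover's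
frame `G` to a standard dozen `sigFrame ε '' fccSlots`, the end move is re-read in the standard frame.

* `forall_slots_iff_image` — `(∀ w ∈ fccSlots, P (G w)) ↔ (∀ y ∈ G '' fccSlots, P y)`;
* `isMenuNormal_congr`, `isFull_congr`, `isTwinReading_congr`, `isNarrow_congr`, `isMoving_congr`, **`isEndMove_congr`** —
  two frames with the same slot dozen `G '' fccSlots = G' '' fccSlots` define the same predicates (the cross branch uses
  `(G ≫ R_m) '' fccSlots = R_m '' (G '' fccSlots)`).
WHAT THIS IS NOT: not the bridge; F-C1 not moved.
-/

noncomputable section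

namespace Summit.Ventures.Crystal3D.Theorems

open Summit.Ventures.Crystal3D Finset
open scoped InnerProductSpace

section Congr

variable {X : Finset (EuclideanSpace ℝ (Fin 3))}
  {G G' : EuclideanSpace ℝ (Fin 3) ≃ₗᵢ[ℝ] EuclideanSpace ℝ (Fin 3)}

/-- Quantifying over the slots of `G` is quantifying over the slot dozen `G '' fccSlots`. -/
theorem forall_slots_iff_image (G : EuclideanSpace ℝ (Fin 3) ≃ₗᵢ[ℝ] EuclideanSpace ℝ (Fin 3))
    (P : EuclideanSpace ℝ (Fin 3) → Prop) :
    (∀ w ∈ fccSlots, P (G w)) ↔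
      ∀ y ∈ (G : EuclideanSpace ℝ (Fin 3) → EuclideanSpace ℝ (Fin 3)) '' ↑fccSlots, P y := by
  constructor
  · rintro h y ⟨w, hw, rfl⟩
    exact h w (mem_coe.1 hw)
  · intro h w hw
    exact h (G w) ⟨w, mem_coe.2 hw, rfl⟩

/-- Transfer of a slot-quantified property along equal slot dozens. -/
theorem forall_slots_congr
    (h : (G : EuclideanSpace ℝ (Fin 3) → EuclideanSpace ℝ (Fin 3)) '' ↑fccSlots =
      (G' : EuclideanSpace ℝ (Fin 3) → EuclideanSpace ℝ (Fin 3)) '' ↑fccSlots)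
    (P : EuclideanSpace ℝ (Fin 3) → Prop) :
    (∀ w ∈ fccSlots, P (G w)) ↔ (∀ w ∈ fccSlots, P (G' w)) := by
  rw [forall_slots_iff_image G P, forall_slots_iff_image G' P, h]

/-- `IsMenuNormal` depends on the slot dozen only. -/
theorem isMenuNormal_congr
    (h : (G : EuclideanSpace ℝ (Fin 3) → EuclideanSpace ℝ (Fin 3)) '' ↑fccSlots =
      (G' : EuclideanSpace ℝ (Fin 3) → EuclideanSpace ℝ (Fin 3)) '' ↑fccSlots)
    (m : EuclideanSpace ℝ (Fin 3)) : IsMenuNormal G m ↔ IsMenuNormal G' m := by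
  unfold IsMenuNormal
  rw [forall_slots_congr h (fun y => ⟪y, m⟫_ℝ = 0 ∨ ⟪y, m⟫_ℝ = Real.sqrt (2 / 3) ∨ ⟪y, m⟫_ℝ = -Real.sqrt (2 / 3))]

/-- `IsFull` depends on the slot dozen only. -/
theorem isFull_congr
    (h : (G : EuclideanSpace ℝ (Fin 3) → EuclideanSpace ℝ (Fin 3)) '' ↑fccSlots =
      (G' : EuclideanSpace ℝ (Fin 3) → EuclideanSpace ℝ (Fin 3)) '' ↑fccSlots)
    (b : EuclideanSpace ℝ (Fin 3)) : IsFull X G b ↔ IsFull X G' b := by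
  unfold IsFull
  exact forall_slots_congr h (fun y => b + y ∈ X)

/-- `IsTwinReading` depends on the slot dozen only. -/
theorem isTwinReading_congr
    (h : (G : EuclideanSpace ℝ (Fin 3) → EuclideanSpace ℝ (Fin 3)) '' ↑fccSlots =
      (G' : EuclideanSpace ℝ (Fin 3) → EuclideanSpace ℝ (Fin 3)) '' ↑fccSlots)
    (m b : EuclideanSpace ℝ (Fin 3)) : IsTwinReading X G m b ↔ IsTwinReading X G' m b := by
  unfold IsTwinReading
  rw [isMenuNormal_congr h m, forall_slots_congr h (fun y => ⟪y, m⟫_ℝ ≤ 0 → b + y ∈ X),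
    forall_slots_congr h (fun y => ⟪y, m⟫_ℝ < 0 → b + (y - (2 * ⟪y, m⟫_ℝ) • m) ∈ X),
    forall_slots_congr h (fun y => 0 < ⟪y, m⟫_ℝ → b + y ∉ X)]

/-- `IsNarrow` depends on the slot dozen only. -/
theorem isNarrow_congr
    (h : (G : EuclideanSpace ℝ (Fin 3) → EuclideanSpace ℝ (Fin 3)) '' ↑fccSlots =
      (G' : EuclideanSpace ℝ (Fin 3) → EuclideanSpace ℝ (Fin 3)) '' ↑fccSlots)
    (d b : EuclideanSpace ℝ (Fin 3)) : IsNarrow X G d b ↔ IsNarrow X G' d b := by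
  unfold IsNarrow
  refine and_congr Iff.rfl (exists_congr fun m => ?_)
  rw [isMenuNormal_congr h m, forall_slots_congr h (fun y => 0 < ⟪y, m⟫_ℝ → b + y ∈ X)]

/-- `IsMoving` depends on the slot dozen only. -/
theorem isMoving_congr
    (h : (G : EuclideanSpace ℝ (Fin 3) → EuclideanSpace ℝ (Fin 3)) '' ↑fccSlots =
      (G' : EuclideanSpace ℝ (Fin 3) → EuclideanSpace ℝ (Fin 3)) '' ↑fccSlots)
    (v : WordVersion) (d b : EuclideanSpace ℝ (Fin 3)) : IsMoving X v G d b ↔ IsMoving X v G' d b := by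
  unfold IsMoving
  rw [isFull_congr h b, isNarrow_congr h d b]
  refine or_congr Iff.rfl (or_congr (exists_congr fun m => ?_) Iff.rfl)
  rw [isTwinReading_congr h m b]

/-- The mirrored frames of two frames with the same slot dozen have the same slot dozen. -/
theorem image_trans_reflection_congr
    (h : (G : EuclideanSpace ℝ (Fin 3) → EuclideanSpace ℝ (Fin 3)) '' ↑fccSlots =
      (G' : EuclideanSpace ℝ (Fin 3) → EuclideanSpace ℝ (Fin 3)) '' ↑fccSlots)
    (m : EuclideanSpace ℝ (Fin 3)) :
    ((G.trans (ℝ ∙ m)ᗮ.reflection : EuclideanSpace ℝ (Fin 3) ≃ₗᵢ[ℝ] EuclideanSpace ℝ (Fin 3)) :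
        EuclideanSpace ℝ (Fin 3) → EuclideanSpace ℝ (Fin 3)) '' ↑fccSlots =
      ((G'.trans (ℝ ∙ m)ᗮ.reflection : EuclideanSpace ℝ (Fin 3) ≃ₗᵢ[ℝ] EuclideanSpace ℝ (Fin 3)) :
        EuclideanSpace ℝ (Fin 3) → EuclideanSpace ℝ (Fin 3)) '' ↑fccSlots := by
  have e : ∀ F : EuclideanSpace ℝ (Fin 3) ≃ₗᵢ[ℝ] EuclideanSpace ℝ (Fin 3),
      ((F.trans (ℝ ∙ m)ᗮ.reflection : EuclideanSpace ℝ (Fin 3) ≃ₗᵢ[ℝ] EuclideanSpace ℝ (Fin 3)) :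
          EuclideanSpace ℝ (Fin 3) → EuclideanSpace ℝ (Fin 3)) '' ↑fccSlots =
        ((ℝ ∙ m)ᗮ.reflection : EuclideanSpace ℝ (Fin 3) → EuclideanSpace ℝ (Fin 3)) ''
          ((F : EuclideanSpace ℝ (Fin 3) → EuclideanSpace ℝ (Fin 3)) '' ↑fccSlots) := by
    intro F
    rw [Set.image_image]
    rfl
  rw [e G, e G', h]

/-- **`IsEndMove` depends on the slot dozen only.** -/
theorem isEndMove_congr
    (h : (G : EuclideanSpace ℝ (Fin 3) → EuclideanSpace ℝ (Fin 3)) '' ↑fccSlots =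
      (G' : EuclideanSpace ℝ (Fin 3) → EuclideanSpace ℝ (Fin 3)) '' ↑fccSlots)
    (v : WordVersion) (d q b : EuclideanSpace ℝ (Fin 3)) : IsEndMove X v G d q b ↔ IsEndMove X v G' d q b := by
  unfold IsEndMove
  rw [isFull_congr h q, isNarrow_congr h d q, isMoving_congr h v d b]
  refine or_congr (and_congr (or_congr Iff.rfl (or_congr Iff.rfl (exists_congr fun m => ?_))) Iff.rfl)
    (exists_congr fun m => ?_)
  · rw [isTwinReading_congr h m q]
  · rw [isTwinReading_congr h m q, isMoving_congr (image_trans_reflection_congr h m) v (b - q) b]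

end Congr

end Summit.Ventures.Crystal3D.Theorems

end
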